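import Summits.RiemannHypothesis.RiemannHypothesis.Theorems.WeilFormatCDataO100FrontData
import Summits.RiemannHypothesis.RiemannHypothesis.Theorems.WeilFormatCDataO100Tables
import Summits.RiemannHypothesis.RiemannHypothesis.Theorems.WeilFormatCDataO100TabValid4B
import Summits.RiemannHypothesis.RiemannHypothesis.Theorems.WeilFormatCDataO100TabValid5B
import Summits.RiemannHypothesis.RiemannHypothesis.Theorems.WeilFormatCDataO100TabValid
import Summits.RiemannHypothesis.RiemannHypothesis.Theorems.WeilFormatCDataA1RungCB
import Summits.RiemannHypothesis.RiemannHypothesis.Theorems.S2FormatCE0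
import Literature.NumberTheory.LFunctions.YoshidaWindowGramTailMSSines
import Literature.NumberTheory.LFunctions.YoshidaWindowGramMiddleJBox
import Literature.NumberTheory.LFunctions.YoshidaWindowGramTailJFactoredScaled
import Literature.NumberTheory.LFunctions.YoshidaWindowGramTailMSFactored
import Literature.NumberTheory.LFunctions.YoshidaWindowGramTailJDiagTight
import Summits.RiemannHypothesis.RiemannHypothesis.Theorems.FormatCPsdBands
import Summits.RiemannHypothesis.RiemannHypothesis.Theorems.WeilFormatCDiagShift
import HarnessLib
import Summits.RiemannHypothesis.RiemannHypothesis.Theorems.WeilFormatCDataO100OddAsmA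

/-!
# Format C kernel rung `O100` (a = 1/1, column-band layout): ASSEMBLY of the flat layout, part B of 6 (ladders of TabValid4, TabValid5, TabValid; split of the 1606-line assembly at block boundaries by prover B g19 for the 400-line cap; blocks byte-identical): every propositional ladder of the kernel files (table/column validity, front door, sines, middle moments, column data, tail factors, Schur rows, (P) + diagonal shift), byte-identical statements and proofs, original order (A g22 restage_flat.py; weil-2 KERNEL-CHAIN-RULES #1)

Window `a = 1/1`; prime powers in the window: 2, 3, 2^2, 5, 7; prime constant A = 2027/1000 (`WeilFormatC.primeCoeff_form_ge_cells_one_v2`); evaluator parameters S = 2^256, Kpi 130, Kser 150, kred 8, Kexp 45, J 120; full table modes < 193; light column table modes < 1027; units 2^-250 (Schur entries), 2^-124 (column digits, width 127), 2^-118 (tail-factor digits, width 121), 2^-64 (reciprocal weights), 2^-40 (tail base); order-J tail J = 4, θ = 1/2048, η = 1/10 | 4/1.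
Design row: sr-gb-rung-a A g23 odd λ-run (parity cell 12 L-side): a = 1, μ = 2^-88, odd 192/384/1024, MS tail, five prime powers; see HOME(A)/LADDER-LSIDES-FORMATC-A-g22.md and <A g23 folder>/NOTES.md. Generated by sr-gb-rung-a prover A g22 with rh-explicit-weil-2 gen7's generator extended for the odd λ-run (--sector odd --mu-log2; HOME(A)/code-g22/gen7/gramgen7.py sha16 a23c12b0192f5d01) from `#eval` of the tree's `Encl` functions; every datum is re-verified by the kernel in the theorem files (`decide +kernel`). Helper data of the rh-explicit Weil-positivity programme (format C, K-CELL-2), RH-free. [cite: Yoshida1992HermitianForms, §5 (5.15)-(5.16) p. 301; §7 pp. 305–312]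
-/

set_option linter.dupNamespace false
set_option maxRecDepth 200000

-- ===== from WeilFormatCDataO100TabValid4 =====
namespace Summit.RiemannHypothesis.RiemannHypothesis.Theorems.WeilFormatCData.O100
open Literature.NumberTheory.LFunctions Literature.NumberTheory.LFunctions.Yoshida1992 Encl Literature.Analysis.ValidatedNumerics.NumericsMP

/-- the special-value table is valid below `134` (partial). -/
theorem tabv134 : TabValid (2 ^ 256) O100.a O100.ks 134 O100.tab := by
  have h98 : TabValid (2 ^ 256) a ks 98 tab := tabv98
  have h99 : TabValid (2 ^ 256) a ks (98 + 1) tab :=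
    h98.extend fun n hn hnk ↦ idxValid_of_checkTable (prm := prm) (by norm_num [prm]) a_pos consts_valid (not_not.mp tT98b) hn hnk
  have h100 : TabValid (2 ^ 256) a ks (99 + 1) tab :=
    h99.extend fun n hn hnk ↦ idxValid_of_checkTable (prm := prm) (by norm_num [prm]) a_pos consts_valid (not_not.mp tT99b) hn hnk
  have h101 : TabValid (2 ^ 256) a ks (100 + 1) tab :=
    h100.extend fun n hn hnk ↦ idxValid_of_checkTable (prm := prm) (by norm_num [prm]) a_pos consts_valid (not_not.mp tT100b) hn hnk
  have h102 : TabValid (2 ^ 256) a ks (101 + 1) tab :=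
    h101.extend fun n hn hnk ↦ idxValid_of_checkTable (prm := prm) (by norm_num [prm]) a_pos consts_valid (not_not.mp tT101b) hn hnk
  have h103 : TabValid (2 ^ 256) a ks (102 + 1) tab :=
    h102.extend fun n hn hnk ↦ idxValid_of_checkTable (prm := prm) (by norm_num [prm]) a_pos consts_valid (not_not.mp tT102b) hn hnk
  have h104 : TabValid (2 ^ 256) a ks (103 + 1) tab :=
    h103.extend fun n hn hnk ↦ idxValid_of_checkTable (prm := prm) (by norm_num [prm]) a_pos consts_valid (not_not.mp tT103b) hn hnk
  have h105 : TabValid (2 ^ 256) a ks (104 + 1) tab :=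
    h104.extend fun n hn hnk ↦ idxValid_of_checkTable (prm := prm) (by norm_num [prm]) a_pos consts_valid (not_not.mp tT104b) hn hnk
  have h106 : TabValid (2 ^ 256) a ks (105 + 1) tab :=
    h105.extend fun n hn hnk ↦ idxValid_of_checkTable (prm := prm) (by norm_num [prm]) a_pos consts_valid (not_not.mp tT105b) hn hnk
  have h107 : TabValid (2 ^ 256) a ks (106 + 1) tab :=
    h106.extend fun n hn hnk ↦ idxValid_of_checkTable (prm := prm) (by norm_num [prm]) a_pos consts_valid (not_not.mp tT106b) hn hnk
  have h108 : TabValid (2 ^ 256) a ks (107 + 1) tab :=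
    h107.extend fun n hn hnk ↦ idxValid_of_checkTable (prm := prm) (by norm_num [prm]) a_pos consts_valid (not_not.mp tT107b) hn hnk
  have h109 : TabValid (2 ^ 256) a ks (108 + 1) tab :=
    h108.extend fun n hn hnk ↦ idxValid_of_checkTable (prm := prm) (by norm_num [prm]) a_pos consts_valid (not_not.mp tT108b) hn hnk
  have h110 : TabValid (2 ^ 256) a ks (109 + 1) tab :=
    h109.extend fun n hn hnk ↦ idxValid_of_checkTable (prm := prm) (by norm_num [prm]) a_pos consts_valid (not_not.mp tT109b) hn hnk
  have h111 : TabValid (2 ^ 256) a ks (110 + 1) tab :=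
    h110.extend fun n hn hnk ↦ idxValid_of_checkTable (prm := prm) (by norm_num [prm]) a_pos consts_valid (not_not.mp tT110b) hn hnk
  have h112 : TabValid (2 ^ 256) a ks (111 + 1) tab :=
    h111.extend fun n hn hnk ↦ idxValid_of_checkTable (prm := prm) (by norm_num [prm]) a_pos consts_valid (not_not.mp tT111b) hn hnk
  have h113 : TabValid (2 ^ 256) a ks (112 + 1) tab :=
    h112.extend fun n hn hnk ↦ idxValid_of_checkTable (prm := prm) (by norm_num [prm]) a_pos consts_valid (not_not.mp tT112b) hn hnk
  have h114 : TabValid (2 ^ 256) a ks (113 + 1) tab :=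
    h113.extend fun n hn hnk ↦ idxValid_of_checkTable (prm := prm) (by norm_num [prm]) a_pos consts_valid (not_not.mp tT113b) hn hnk
  have h115 : TabValid (2 ^ 256) a ks (114 + 1) tab :=
    h114.extend fun n hn hnk ↦ idxValid_of_checkTable (prm := prm) (by norm_num [prm]) a_pos consts_valid (not_not.mp tT114b) hn hnk
  have h116 : TabValid (2 ^ 256) a ks (115 + 1) tab :=
    h115.extend fun n hn hnk ↦ idxValid_of_checkTable (prm := prm) (by norm_num [prm]) a_pos consts_valid (not_not.mp tT115b) hn hnk
  have h117 : TabValid (2 ^ 256) a ks (116 + 1) tab :=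
    h116.extend fun n hn hnk ↦ idxValid_of_checkTable (prm := prm) (by norm_num [prm]) a_pos consts_valid (not_not.mp tT116b) hn hnk
  have h118 : TabValid (2 ^ 256) a ks (117 + 1) tab :=
    h117.extend fun n hn hnk ↦ idxValid_of_checkTable (prm := prm) (by norm_num [prm]) a_pos consts_valid (not_not.mp tT117b) hn hnk
  have h119 : TabValid (2 ^ 256) a ks (118 + 1) tab :=
    h118.extend fun n hn hnk ↦ idxValid_of_checkTable (prm := prm) (by norm_num [prm]) a_pos consts_valid (not_not.mp tT118b) hn hnk
  have h120 : TabValid (2 ^ 256) a ks (119 + 1) tab :=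
    h119.extend fun n hn hnk ↦ idxValid_of_checkTable (prm := prm) (by norm_num [prm]) a_pos consts_valid (not_not.mp tT119b) hn hnk
  have h121 : TabValid (2 ^ 256) a ks (120 + 1) tab :=
    h120.extend fun n hn hnk ↦ idxValid_of_checkTable (prm := prm) (by norm_num [prm]) a_pos consts_valid (not_not.mp tT120b) hn hnk
  have h122 : TabValid (2 ^ 256) a ks (121 + 1) tab :=
    h121.extend fun n hn hnk ↦ idxValid_of_checkTable (prm := prm) (by norm_num [prm]) a_pos consts_valid (not_not.mp tT121b) hn hnk
  have h123 : TabValid (2 ^ 256) a ks (122 + 1) tab :=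
    h122.extend fun n hn hnk ↦ idxValid_of_checkTable (prm := prm) (by norm_num [prm]) a_pos consts_valid (not_not.mp tT122b) hn hnk
  have h124 : TabValid (2 ^ 256) a ks (123 + 1) tab :=
    h123.extend fun n hn hnk ↦ idxValid_of_checkTable (prm := prm) (by norm_num [prm]) a_pos consts_valid (not_not.mp tT123b) hn hnk
  have h125 : TabValid (2 ^ 256) a ks (124 + 1) tab :=
    h124.extend fun n hn hnk ↦ idxValid_of_checkTable (prm := prm) (by norm_num [prm]) a_pos consts_valid (not_not.mp tT124b) hn hnk
  have h126 : TabValid (2 ^ 256) a ks (125 + 1) tab :=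
    h125.extend fun n hn hnk ↦ idxValid_of_checkTable (prm := prm) (by norm_num [prm]) a_pos consts_valid (not_not.mp tT125b) hn hnk
  have h127 : TabValid (2 ^ 256) a ks (126 + 1) tab :=
    h126.extend fun n hn hnk ↦ idxValid_of_checkTable (prm := prm) (by norm_num [prm]) a_pos consts_valid (not_not.mp tT126b) hn hnk
  have h128 : TabValid (2 ^ 256) a ks (127 + 1) tab :=
    h127.extend fun n hn hnk ↦ idxValid_of_checkTable (prm := prm) (by norm_num [prm]) a_pos consts_valid (not_not.mp tT127b) hn hnk
  have h129 : TabValid (2 ^ 256) a ks (128 + 1) tab :=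
    h128.extend fun n hn hnk ↦ idxValid_of_checkTable (prm := prm) (by norm_num [prm]) a_pos consts_valid (not_not.mp tT128b) hn hnk
  have h130 : TabValid (2 ^ 256) a ks (129 + 1) tab :=
    h129.extend fun n hn hnk ↦ idxValid_of_checkTable (prm := prm) (by norm_num [prm]) a_pos consts_valid (not_not.mp tT129b) hn hnk
  have h131 : TabValid (2 ^ 256) a ks (130 + 1) tab :=
    h130.extend fun n hn hnk ↦ idxValid_of_checkTable (prm := prm) (by norm_num [prm]) a_pos consts_valid (not_not.mp tT130b) hn hnk
  have h132 : TabValid (2 ^ 256) a ks (131 + 1) tab :=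
    h131.extend fun n hn hnk ↦ idxValid_of_checkTable (prm := prm) (by norm_num [prm]) a_pos consts_valid (not_not.mp tT131b) hn hnk
  have h133 : TabValid (2 ^ 256) a ks (132 + 1) tab :=
    h132.extend fun n hn hnk ↦ idxValid_of_checkTable (prm := prm) (by norm_num [prm]) a_pos consts_valid (not_not.mp tT132b) hn hnk
  have h134 : TabValid (2 ^ 256) a ks (133 + 1) tab :=
    h133.extend fun n hn hnk ↦ idxValid_of_checkTable (prm := prm) (by norm_num [prm]) a_pos consts_valid (not_not.mp tT133b) hn hnk
  exact h134

end Summit.RiemannHypothesis.RiemannHypothesis.Theorems.WeilFormatCData.O100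

-- ===== from WeilFormatCDataO100TabValid5 =====
namespace Summit.RiemannHypothesis.RiemannHypothesis.Theorems.WeilFormatCData.O100
open Literature.NumberTheory.LFunctions Literature.NumberTheory.LFunctions.Yoshida1992 Encl Literature.Analysis.ValidatedNumerics.NumericsMP

/-- the special-value table is valid below `170` (partial). -/
theorem tabv170 : TabValid (2 ^ 256) O100.a O100.ks 170 O100.tab := by
  have h134 : TabValid (2 ^ 256) a ks 134 tab := tabv134
  have h135 : TabValid (2 ^ 256) a ks (134 + 1) tab :=
    h134.extend fun n hn hnk ↦ idxValid_of_checkTable (prm := prm) (by norm_num [prm]) a_pos consts_valid (not_not.mp tT134b) hn hnk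
  have h136 : TabValid (2 ^ 256) a ks (135 + 1) tab :=
    h135.extend fun n hn hnk ↦ idxValid_of_checkTable (prm := prm) (by norm_num [prm]) a_pos consts_valid (not_not.mp tT135b) hn hnk
  have h137 : TabValid (2 ^ 256) a ks (136 + 1) tab :=
    h136.extend fun n hn hnk ↦ idxValid_of_checkTable (prm := prm) (by norm_num [prm]) a_pos consts_valid (not_not.mp tT136b) hn hnk
  have h138 : TabValid (2 ^ 256) a ks (137 + 1) tab :=
    h137.extend fun n hn hnk ↦ idxValid_of_checkTable (prm := prm) (by norm_num [prm]) a_pos consts_valid (not_not.mp tT137b) hn hnk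
  have h139 : TabValid (2 ^ 256) a ks (138 + 1) tab :=
    h138.extend fun n hn hnk ↦ idxValid_of_checkTable (prm := prm) (by norm_num [prm]) a_pos consts_valid (not_not.mp tT138b) hn hnk
  have h140 : TabValid (2 ^ 256) a ks (139 + 1) tab :=
    h139.extend fun n hn hnk ↦ idxValid_of_checkTable (prm := prm) (by norm_num [prm]) a_pos consts_valid (not_not.mp tT139b) hn hnk
  have h141 : TabValid (2 ^ 256) a ks (140 + 1) tab :=
    h140.extend fun n hn hnk ↦ idxValid_of_checkTable (prm := prm) (by norm_num [prm]) a_pos consts_valid (not_not.mp tT140b) hn hnk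
  have h142 : TabValid (2 ^ 256) a ks (141 + 1) tab :=
    h141.extend fun n hn hnk ↦ idxValid_of_checkTable (prm := prm) (by norm_num [prm]) a_pos consts_valid (not_not.mp tT141b) hn hnk
  have h143 : TabValid (2 ^ 256) a ks (142 + 1) tab :=
    h142.extend fun n hn hnk ↦ idxValid_of_checkTable (prm := prm) (by norm_num [prm]) a_pos consts_valid (not_not.mp tT142b) hn hnk
  have h144 : TabValid (2 ^ 256) a ks (143 + 1) tab :=
    h143.extend fun n hn hnk ↦ idxValid_of_checkTable (prm := prm) (by norm_num [prm]) a_pos consts_valid (not_not.mp tT143b) hn hnk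
  have h145 : TabValid (2 ^ 256) a ks (144 + 1) tab :=
    h144.extend fun n hn hnk ↦ idxValid_of_checkTable (prm := prm) (by norm_num [prm]) a_pos consts_valid (not_not.mp tT144b) hn hnk
  have h146 : TabValid (2 ^ 256) a ks (145 + 1) tab :=
    h145.extend fun n hn hnk ↦ idxValid_of_checkTable (prm := prm) (by norm_num [prm]) a_pos consts_valid (not_not.mp tT145b) hn hnk
  have h147 : TabValid (2 ^ 256) a ks (146 + 1) tab :=
    h146.extend fun n hn hnk ↦ idxValid_of_checkTable (prm := prm) (by norm_num [prm]) a_pos consts_valid (not_not.mp tT146b) hn hnk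
  have h148 : TabValid (2 ^ 256) a ks (147 + 1) tab :=
    h147.extend fun n hn hnk ↦ idxValid_of_checkTable (prm := prm) (by norm_num [prm]) a_pos consts_valid (not_not.mp tT147b) hn hnk
  have h149 : TabValid (2 ^ 256) a ks (148 + 1) tab :=
    h148.extend fun n hn hnk ↦ idxValid_of_checkTable (prm := prm) (by norm_num [prm]) a_pos consts_valid (not_not.mp tT148b) hn hnk
  have h150 : TabValid (2 ^ 256) a ks (149 + 1) tab :=
    h149.extend fun n hn hnk ↦ idxValid_of_checkTable (prm := prm) (by norm_num [prm]) a_pos consts_valid (not_not.mp tT149b) hn hnk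
  have h151 : TabValid (2 ^ 256) a ks (150 + 1) tab :=
    h150.extend fun n hn hnk ↦ idxValid_of_checkTable (prm := prm) (by norm_num [prm]) a_pos consts_valid (not_not.mp tT150b) hn hnk
  have h152 : TabValid (2 ^ 256) a ks (151 + 1) tab :=
    h151.extend fun n hn hnk ↦ idxValid_of_checkTable (prm := prm) (by norm_num [prm]) a_pos consts_valid (not_not.mp tT151b) hn hnk
  have h153 : TabValid (2 ^ 256) a ks (152 + 1) tab :=
    h152.extend fun n hn hnk ↦ idxValid_of_checkTable (prm := prm) (by norm_num [prm]) a_pos consts_valid (not_not.mp tT152b) hn hnk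
  have h154 : TabValid (2 ^ 256) a ks (153 + 1) tab :=
    h153.extend fun n hn hnk ↦ idxValid_of_checkTable (prm := prm) (by norm_num [prm]) a_pos consts_valid (not_not.mp tT153b) hn hnk
  have h155 : TabValid (2 ^ 256) a ks (154 + 1) tab :=
    h154.extend fun n hn hnk ↦ idxValid_of_checkTable (prm := prm) (by norm_num [prm]) a_pos consts_valid (not_not.mp tT154b) hn hnk
  have h156 : TabValid (2 ^ 256) a ks (155 + 1) tab :=
    h155.extend fun n hn hnk ↦ idxValid_of_checkTable (prm := prm) (by norm_num [prm]) a_pos consts_valid (not_not.mp tT155b) hn hnk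
  have h157 : TabValid (2 ^ 256) a ks (156 + 1) tab :=
    h156.extend fun n hn hnk ↦ idxValid_of_checkTable (prm := prm) (by norm_num [prm]) a_pos consts_valid (not_not.mp tT156b) hn hnk
  have h158 : TabValid (2 ^ 256) a ks (157 + 1) tab :=
    h157.extend fun n hn hnk ↦ idxValid_of_checkTable (prm := prm) (by norm_num [prm]) a_pos consts_valid (not_not.mp tT157b) hn hnk
  have h159 : TabValid (2 ^ 256) a ks (158 + 1) tab :=
    h158.extend fun n hn hnk ↦ idxValid_of_checkTable (prm := prm) (by norm_num [prm]) a_pos consts_valid (not_not.mp tT158b) hn hnk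
  have h160 : TabValid (2 ^ 256) a ks (159 + 1) tab :=
    h159.extend fun n hn hnk ↦ idxValid_of_checkTable (prm := prm) (by norm_num [prm]) a_pos consts_valid (not_not.mp tT159b) hn hnk
  have h161 : TabValid (2 ^ 256) a ks (160 + 1) tab :=
    h160.extend fun n hn hnk ↦ idxValid_of_checkTable (prm := prm) (by norm_num [prm]) a_pos consts_valid (not_not.mp tT160b) hn hnk
  have h162 : TabValid (2 ^ 256) a ks (161 + 1) tab :=
    h161.extend fun n hn hnk ↦ idxValid_of_checkTable (prm := prm) (by norm_num [prm]) a_pos consts_valid (not_not.mp tT161b) hn hnk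
  have h163 : TabValid (2 ^ 256) a ks (162 + 1) tab :=
    h162.extend fun n hn hnk ↦ idxValid_of_checkTable (prm := prm) (by norm_num [prm]) a_pos consts_valid (not_not.mp tT162b) hn hnk
  have h164 : TabValid (2 ^ 256) a ks (163 + 1) tab :=
    h163.extend fun n hn hnk ↦ idxValid_of_checkTable (prm := prm) (by norm_num [prm]) a_pos consts_valid (not_not.mp tT163b) hn hnk
  have h165 : TabValid (2 ^ 256) a ks (164 + 1) tab :=
    h164.extend fun n hn hnk ↦ idxValid_of_checkTable (prm := prm) (by norm_num [prm]) a_pos consts_valid (not_not.mp tT164b) hn hnk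
  have h166 : TabValid (2 ^ 256) a ks (165 + 1) tab :=
    h165.extend fun n hn hnk ↦ idxValid_of_checkTable (prm := prm) (by norm_num [prm]) a_pos consts_valid (not_not.mp tT165b) hn hnk
  have h167 : TabValid (2 ^ 256) a ks (166 + 1) tab :=
    h166.extend fun n hn hnk ↦ idxValid_of_checkTable (prm := prm) (by norm_num [prm]) a_pos consts_valid (not_not.mp tT166b) hn hnk
  have h168 : TabValid (2 ^ 256) a ks (167 + 1) tab :=
    h167.extend fun n hn hnk ↦ idxValid_of_checkTable (prm := prm) (by norm_num [prm]) a_pos consts_valid (not_not.mp tT167b) hn hnk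
  have h169 : TabValid (2 ^ 256) a ks (168 + 1) tab :=
    h168.extend fun n hn hnk ↦ idxValid_of_checkTable (prm := prm) (by norm_num [prm]) a_pos consts_valid (not_not.mp tT168b) hn hnk
  have h170 : TabValid (2 ^ 256) a ks (169 + 1) tab :=
    h169.extend fun n hn hnk ↦ idxValid_of_checkTable (prm := prm) (by norm_num [prm]) a_pos consts_valid (not_not.mp tT169b) hn hnk
  exact h170

end Summit.RiemannHypothesis.RiemannHypothesis.Theorems.WeilFormatCData.O100

-- ===== from WeilFormatCDataO100TabValid =====
namespace Summit.RiemannHypothesis.RiemannHypothesis.Theorems.WeilFormatCData.O100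
open Literature.NumberTheory.LFunctions Literature.NumberTheory.LFunctions.Yoshida1992 Encl Literature.Analysis.ValidatedNumerics.NumericsMP

/-- the special-value table is valid below `193`. -/
theorem tab_valid : TabValid (2 ^ 256) O100.a O100.ks 193 O100.tab := by
  have h170 : TabValid (2 ^ 256) a ks 170 tab := tabv170
  have h171 : TabValid (2 ^ 256) a ks (170 + 1) tab :=
    h170.extend fun n hn hnk ↦ idxValid_of_checkTable (prm := prm) (by norm_num [prm]) a_pos consts_valid tT170 hn hnk
  have h172 : TabValid (2 ^ 256) a ks (171 + 1) tab :=
    h171.extend fun n hn hnk ↦ idxValid_of_checkTable (prm := prm) (by norm_num [prm]) a_pos consts_valid tT171 hn hnk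
  have h173 : TabValid (2 ^ 256) a ks (172 + 1) tab :=
    h172.extend fun n hn hnk ↦ idxValid_of_checkTable (prm := prm) (by norm_num [prm]) a_pos consts_valid tT172 hn hnk
  have h174 : TabValid (2 ^ 256) a ks (173 + 1) tab :=
    h173.extend fun n hn hnk ↦ idxValid_of_checkTable (prm := prm) (by norm_num [prm]) a_pos consts_valid tT173 hn hnk
  have h175 : TabValid (2 ^ 256) a ks (174 + 1) tab :=
    h174.extend fun n hn hnk ↦ idxValid_of_checkTable (prm := prm) (by norm_num [prm]) a_pos consts_valid tT174 hn hnk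
  have h176 : TabValid (2 ^ 256) a ks (175 + 1) tab :=
    h175.extend fun n hn hnk ↦ idxValid_of_checkTable (prm := prm) (by norm_num [prm]) a_pos consts_valid tT175 hn hnk
  have h177 : TabValid (2 ^ 256) a ks (176 + 1) tab :=
    h176.extend fun n hn hnk ↦ idxValid_of_checkTable (prm := prm) (by norm_num [prm]) a_pos consts_valid tT176 hn hnk
  have h178 : TabValid (2 ^ 256) a ks (177 + 1) tab :=
    h177.extend fun n hn hnk ↦ idxValid_of_checkTable (prm := prm) (by norm_num [prm]) a_pos consts_valid tT177 hn hnk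
  have h179 : TabValid (2 ^ 256) a ks (178 + 1) tab :=
    h178.extend fun n hn hnk ↦ idxValid_of_checkTable (prm := prm) (by norm_num [prm]) a_pos consts_valid tT178 hn hnk
  have h180 : TabValid (2 ^ 256) a ks (179 + 1) tab :=
    h179.extend fun n hn hnk ↦ idxValid_of_checkTable (prm := prm) (by norm_num [prm]) a_pos consts_valid tT179 hn hnk
  have h181 : TabValid (2 ^ 256) a ks (180 + 1) tab :=
    h180.extend fun n hn hnk ↦ idxValid_of_checkTable (prm := prm) (by norm_num [prm]) a_pos consts_valid tT180 hn hnk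
  have h182 : TabValid (2 ^ 256) a ks (181 + 1) tab :=
    h181.extend fun n hn hnk ↦ idxValid_of_checkTable (prm := prm) (by norm_num [prm]) a_pos consts_valid tT181 hn hnk
  have h183 : TabValid (2 ^ 256) a ks (182 + 1) tab :=
    h182.extend fun n hn hnk ↦ idxValid_of_checkTable (prm := prm) (by norm_num [prm]) a_pos consts_valid tT182 hn hnk
  have h184 : TabValid (2 ^ 256) a ks (183 + 1) tab :=
    h183.extend fun n hn hnk ↦ idxValid_of_checkTable (prm := prm) (by norm_num [prm]) a_pos consts_valid tT183 hn hnk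
  have h185 : TabValid (2 ^ 256) a ks (184 + 1) tab :=
    h184.extend fun n hn hnk ↦ idxValid_of_checkTable (prm := prm) (by norm_num [prm]) a_pos consts_valid tT184 hn hnk
  have h186 : TabValid (2 ^ 256) a ks (185 + 1) tab :=
    h185.extend fun n hn hnk ↦ idxValid_of_checkTable (prm := prm) (by norm_num [prm]) a_pos consts_valid tT185 hn hnk
  have h187 : TabValid (2 ^ 256) a ks (186 + 1) tab :=
    h186.extend fun n hn hnk ↦ idxValid_of_checkTable (prm := prm) (by norm_num [prm]) a_pos consts_valid tT186 hn hnk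
  have h188 : TabValid (2 ^ 256) a ks (187 + 1) tab :=
    h187.extend fun n hn hnk ↦ idxValid_of_checkTable (prm := prm) (by norm_num [prm]) a_pos consts_valid tT187 hn hnk
  have h189 : TabValid (2 ^ 256) a ks (188 + 1) tab :=
    h188.extend fun n hn hnk ↦ idxValid_of_checkTable (prm := prm) (by norm_num [prm]) a_pos consts_valid tT188 hn hnk
  have h190 : TabValid (2 ^ 256) a ks (189 + 1) tab :=
    h189.extend fun n hn hnk ↦ idxValid_of_checkTable (prm := prm) (by norm_num [prm]) a_pos consts_valid tT189 hn hnk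
  have h191 : TabValid (2 ^ 256) a ks (190 + 1) tab :=
    h190.extend fun n hn hnk ↦ idxValid_of_checkTable (prm := prm) (by norm_num [prm]) a_pos consts_valid tT190 hn hnk
  have h192 : TabValid (2 ^ 256) a ks (191 + 1) tab :=
    h191.extend fun n hn hnk ↦ idxValid_of_checkTable (prm := prm) (by norm_num [prm]) a_pos consts_valid tT191 hn hnk
  have h193 : TabValid (2 ^ 256) a ks (192 + 1) tab :=
    h192.extend fun n hn hnk ↦ idxValid_of_checkTable (prm := prm) (by norm_num [prm]) a_pos consts_valid tT192 hn hnk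
  exact h193

/-- full table for the odd rows. -/
theorem tab_valid_odd : TabValid (2 ^ 256) O100.a O100.ks (192 + 1) O100.tab := fun n hn ↦ tab_valid n (by omega)

end Summit.RiemannHypothesis.RiemannHypothesis.Theorems.WeilFormatCData.O100
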